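import Literature.Analysis.Complex.ArgumentPrincipleRectangle
import HarnessLib

/-!
# Cutting rectangles: additivity of the boundary integral and Cauchy's theorem for a rectangular annulus

Topic `Literature/Analysis/Complex`. Everything here is PROVED (theorems only), in the four-term
convention `rectBoundaryIntegral` of `ArgumentPrincipleRectangle.lean`
(`∮_{∂([a,b]×[c,d])} = ∫_bottom − ∫_top + i∫_right − i∫_left`):

* `rectBoundaryIntegral_split_re`, `rectBoundaryIntegral_split_im` — cutting `[a,b] × [c,d]` by
  the line `Re z = m` (`a ≤ m ≤ b`), resp. `Im z = m`, the boundary integral is the sum of the two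
  boundary integrals (the integrals along the cut cancel); only integrability of the two edges
  that are cut is needed;
* `rectBoundaryIntegral_eq_of_differentiableOn_annulus` — **Cauchy's theorem for a rectangular
  annulus**: if `R' = [a',b'] × [c',d'] ⊆ R = [a,b] × [c,d]` and `F` is complex differentiable on
  the closed region `R ∖ int R'`, then `∮_{∂R} F = ∮_{∂R'} F` (cut `R` by `Re z = a', b'` and
  `Im z = c', d'`: the eight outer pieces have zero boundary integral by Cauchy–Goursat,
  `rectBoundaryIntegral_eq_zero_of_differentiableOn`);
* `intervalIntegrable_horizontal_of_continuousOn`, `intervalIntegrable_vertical_of_continuousOn` —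
  integrability along a segment from continuity on a set containing it.

Use: residue bookkeeping on rectangular contours with several poles (replace the big rectangle by
a small one around the poles), e.g. the double contour integrals of Goldston–Pintz–Yıldırım §8.

## References

* L. V. Ahlfors, *Complex Analysis*, 3rd ed., McGraw–Hill 1979, Ch. 4 §1.4 (Cauchy's theorem for
  a rectangle) and §4.4 (general form); folklore. [folklore]
-/

noncomputable section

open Complex Set MeasureTheory intervalIntegral

namespace Literature.Analysis.Complex

variable {a b c d : ℝ}

/-! ### Integrability along segments from continuity on a set containing them -/

/-- A function continuous on a set containing a horizontal segment is interval integrable along it.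
[folklore] -/
theorem intervalIntegrable_horizontal_of_continuousOn {F : ℂ → ℂ} {S : Set ℂ} (hF : ContinuousOn F S)
    (y : ℝ) (hab : a ≤ b) (hS : ∀ x ∈ Icc a b, ((x : ℂ) + y * I) ∈ S) :
    IntervalIntegrable (fun x : ℝ => F (x + y * I)) volume a b := by
  refine ContinuousOn.intervalIntegrable ?_
  rw [uIcc_of_le hab]
  exact hF.comp (by fun_prop) fun x hx => hS x hx

/-- A function continuous on a set containing a vertical segment is interval integrable along it.
[folklore] -/
theorem intervalIntegrable_vertical_of_continuousOn {F : ℂ → ℂ} {S : Set ℂ} (hF : ContinuousOn F S)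
    (x : ℝ) (hcd : c ≤ d) (hS : ∀ y ∈ Icc c d, ((x : ℂ) + y * I) ∈ S) :
    IntervalIntegrable (fun y : ℝ => F (x + y * I)) volume c d := by
  refine ContinuousOn.intervalIntegrable ?_
  rw [uIcc_of_le hcd]
  exact hF.comp (by fun_prop) fun y hy => hS y hy

/-! ### Splitting a rectangle -/

/-- **Vertical cut.** For `a ≤ m ≤ b`, the boundary integral over `[a,b] × [c,d]` is the sum of
those over `[a,m] × [c,d]` and `[m,b] × [c,d]` (the two integrals along the cut cancel), provided
the bottom and top edges are integrable. [folklore] -/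
theorem rectBoundaryIntegral_split_re {F : ℂ → ℂ} {m : ℝ} (ham : a ≤ m) (hmb : m ≤ b)
    (h_bot : IntervalIntegrable (fun x : ℝ => F (x + c * I)) volume a b)
    (h_top : IntervalIntegrable (fun x : ℝ => F (x + d * I)) volume a b) :
    rectBoundaryIntegral F a b c d =
      rectBoundaryIntegral F a m c d + rectBoundaryIntegral F m b c d := by
  simp only [rectBoundaryIntegral]
  have hab : a ≤ b := ham.trans hmb
  have s1 : uIcc a m ⊆ uIcc a b := by
    rw [uIcc_of_le hab, uIcc_of_le ham]; exact Icc_subset_Icc le_rfl hmb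
  have s2 : uIcc m b ⊆ uIcc a b := by
    rw [uIcc_of_le hab, uIcc_of_le hmb]; exact Icc_subset_Icc ham le_rfl
  rw [← integral_add_adjacent_intervals (h_bot.mono_set s1) (h_bot.mono_set s2),
    ← integral_add_adjacent_intervals (h_top.mono_set s1) (h_top.mono_set s2)]
  ring

/-- **Horizontal cut.** For `c ≤ m ≤ d`, the boundary integral over `[a,b] × [c,d]` is the sum of
those over `[a,b] × [c,m]` and `[a,b] × [m,d]`, provided the left and right edges are integrable.
[folklore] -/
theorem rectBoundaryIntegral_split_im {F : ℂ → ℂ} {m : ℝ} (hcm : c ≤ m) (hmd : m ≤ d)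
    (h_left : IntervalIntegrable (fun y : ℝ => F (a + y * I)) volume c d)
    (h_right : IntervalIntegrable (fun y : ℝ => F (b + y * I)) volume c d) :
    rectBoundaryIntegral F a b c d =
      rectBoundaryIntegral F a b c m + rectBoundaryIntegral F a b m d := by
  simp only [rectBoundaryIntegral]
  have hcd : c ≤ d := hcm.trans hmd
  have s1 : uIcc c m ⊆ uIcc c d := by
    rw [uIcc_of_le hcd, uIcc_of_le hcm]; exact Icc_subset_Icc le_rfl hmd
  have s2 : uIcc m d ⊆ uIcc c d := by
    rw [uIcc_of_le hcd, uIcc_of_le hmd]; exact Icc_subset_Icc hcm le_rfl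
  rw [← integral_add_adjacent_intervals (h_left.mono_set s1) (h_left.mono_set s2),
    ← integral_add_adjacent_intervals (h_right.mono_set s1) (h_right.mono_set s2)]
  ring

/-! ### Nested rectangles -/

/-- **Cauchy's theorem for a rectangular annulus.** Let `R' = [a',b'] × [c',d']` be a rectangle
inside `R = [a,b] × [c,d]` (`a ≤ a' < b' ≤ b`, `c ≤ c' < d' ≤ d`) and let `F` be complex
differentiable on the closed region between them, `R ∖ int R'`. Then `∮_{∂R} F = ∮_{∂R'} F`
(four-term convention): cut `R` by the lines `Re z = a', b'` and `Im z = c', d'`; the eight outer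
pieces have zero boundary integral (Cauchy–Goursat) and the cuts cancel. [folklore] -/
theorem rectBoundaryIntegral_eq_of_differentiableOn_annulus {F : ℂ → ℂ} {a' b' c' d' : ℝ}
    (ha : a ≤ a') (hab' : a' < b') (hb : b' ≤ b) (hc : c ≤ c') (hcd' : c' < d') (hd : d' ≤ d)
    (hF : DifferentiableOn ℂ F ((Icc a b ×ℂ Icc c d) \ (Ioo a' b' ×ℂ Ioo c' d'))) :
    rectBoundaryIntegral F a b c d = rectBoundaryIntegral F a' b' c' d' := by
  set A : Set ℂ := (Icc a b ×ℂ Icc c d) \ (Ioo a' b' ×ℂ Ioo c' d') with hA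
  have hcont : ContinuousOn F A := hF.continuousOn
  have hab : a ≤ b := ha.trans (hab'.le.trans hb)
  have hcd : c ≤ d := hc.trans (hcd'.le.trans hd)
  -- membership of edges and cuts in the annulus
  have memA : ∀ z : ℂ, z.re ∈ Icc a b → z.im ∈ Icc c d →
      (z.re ≤ a' ∨ b' ≤ z.re ∨ z.im ≤ c' ∨ d' ≤ z.im) → z ∈ A := by
    intro z hre him h
    refine ⟨⟨hre, him⟩, fun hz => ?_⟩
    obtain ⟨⟨h1, h2⟩, ⟨h3, h4⟩⟩ := mem_reProdIm.1 hz
    rcases h with h | h | h | h <;> linarith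
  -- horizontal segments at heights `y ∈ {c, d}` or with `y ≤ c'`/`y ≥ d'`, and vertical ones
  have hint_h : ∀ (y : ℝ) (p q : ℝ), a ≤ p → p ≤ q → q ≤ b → y ∈ Icc c d →
      (y ≤ c' ∨ d' ≤ y ∨ q ≤ a' ∨ b' ≤ p) →
      IntervalIntegrable (fun x : ℝ => F (x + y * I)) volume p q := by
    intro y p q hp hpq hq hy hcase
    refine intervalIntegrable_horizontal_of_continuousOn hcont y hpq fun x hx => ?_
    refine memA _ (by simpa using (⟨hp.trans hx.1, hx.2.trans hq⟩ : x ∈ Icc a b)) (by simpa using hy) ?_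
    simp only [add_re, ofReal_re, mul_re, I_re, mul_zero, ofReal_im, I_im, mul_one, sub_self,
      add_zero, add_im, mul_im, zero_add]
    rcases hcase with h | h | h | h
    · exact Or.inr (Or.inr (Or.inl h))
    · exact Or.inr (Or.inr (Or.inr h))
    · exact Or.inl (hx.2.trans h)
    · exact Or.inr (Or.inl (h.trans hx.1))
  have hint_v : ∀ (x : ℝ) (p q : ℝ), c ≤ p → p ≤ q → q ≤ d → x ∈ Icc a b →
      (x ≤ a' ∨ b' ≤ x ∨ q ≤ c' ∨ d' ≤ p) →
      IntervalIntegrable (fun y : ℝ => F (x + y * I)) volume p q := by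
    intro x p q hp hpq hq hx hcase
    refine intervalIntegrable_vertical_of_continuousOn hcont x hpq fun y hy => ?_
    refine memA _ (by simpa using hx) (by simpa using (⟨hp.trans hy.1, hy.2.trans hq⟩ : y ∈ Icc c d)) ?_
    simp only [add_re, ofReal_re, mul_re, I_re, mul_zero, ofReal_im, I_im, mul_one, sub_self,
      add_zero, add_im, mul_im, zero_add]
    rcases hcase with h | h | h | h
    · exact Or.inl h
    · exact Or.inr (Or.inl h)
    · exact Or.inr (Or.inr (Or.inl (hy.2.trans h)))
    · exact Or.inr (Or.inr (Or.inr (h.trans hy.1)))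
  -- Cauchy–Goursat on a closed sub-rectangle contained in the annulus
  have hzero : ∀ (p q r s : ℝ), p ≤ q → r ≤ s → a ≤ p → q ≤ b → c ≤ r → s ≤ d →
      (q ≤ a' ∨ b' ≤ p ∨ s ≤ c' ∨ d' ≤ r) → rectBoundaryIntegral F p q r s = 0 := by
    intro p q r s hpq hrs hp hq hr hs hcase
    refine rectBoundaryIntegral_eq_zero_of_differentiableOn hpq hrs (hF.mono fun z hz => ?_)
    obtain ⟨⟨h1, h2⟩, ⟨h3, h4⟩⟩ := mem_reProdIm.1 hz
    refine memA z ⟨hp.trans h1, h2.trans hq⟩ ⟨hr.trans h3, h4.trans hs⟩ ?_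
    rcases hcase with h | h | h | h
    · exact Or.inl (h2.trans h)
    · exact Or.inr (Or.inl (h.trans h1))
    · exact Or.inr (Or.inr (Or.inl (h4.trans h)))
    · exact Or.inr (Or.inr (Or.inr (h.trans h3)))
  -- columns
  rw [rectBoundaryIntegral_split_re ha (hab'.le.trans hb)
      (hint_h c a b le_rfl hab le_rfl (left_mem_Icc.2 hcd) (Or.inl hc))
      (hint_h d a b le_rfl hab le_rfl (right_mem_Icc.2 hcd) (Or.inr (Or.inl hd))),
    rectBoundaryIntegral_split_re hab'.le hb
      (hint_h c a' b ha ((hab'.le).trans hb) le_rfl (left_mem_Icc.2 hcd) (Or.inl hc))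
      (hint_h d a' b ha ((hab'.le).trans hb) le_rfl (right_mem_Icc.2 hcd) (Or.inr (Or.inl hd))),
    hzero a a' c d ha hcd le_rfl (hab'.le.trans hb) le_rfl le_rfl (Or.inl le_rfl),
    hzero b' b c d hb hcd (ha.trans hab'.le) le_rfl le_rfl le_rfl (Or.inr (Or.inl le_rfl)),
    zero_add, add_zero]
  -- middle column, rows
  have haI : a' ∈ Icc a b := ⟨ha, hab'.le.trans hb⟩
  have hbI : b' ∈ Icc a b := ⟨ha.trans hab'.le, hb⟩
  rw [rectBoundaryIntegral_split_im hc (hcd'.le.trans hd)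
      (hint_v a' c d le_rfl hcd le_rfl haI (Or.inl le_rfl))
      (hint_v b' c d le_rfl hcd le_rfl hbI (Or.inr (Or.inl le_rfl))),
    rectBoundaryIntegral_split_im hcd'.le hd
      (hint_v a' c' d hc (hcd'.le.trans hd) le_rfl haI (Or.inl le_rfl))
      (hint_v b' c' d hc (hcd'.le.trans hd) le_rfl hbI (Or.inr (Or.inl le_rfl))),
    hzero a' b' c c' hab'.le hc ha hb le_rfl (hcd'.le.trans hd) (Or.inr (Or.inr (Or.inl le_rfl))),
    hzero a' b' d' d hab'.le hd ha hb (hc.trans hcd'.le) le_rfl (Or.inr (Or.inr (Or.inr le_rfl))),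
    zero_add, add_zero]

end Literature.Analysis.Complex
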